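import Summits.ABC.IUTFork.Cor312NaiveProvSetting
import Summits.ABC.IUTFork.Cor312ProvenanceQ
import HarnessLib

/-!
# The naive model over ANY index skeleton, IV: the CONTENTFUL gap witness and fork AT THE PROVENANCE LEVEL

Record-only file (D-0012) of the abc-iut cell (D-0067 adjudication, ADJUDICATION-SPEC v2.1 §2 (G3) / (R) / §4 (iii);
support piece «G-NV-PROV» = abc-iut-w5-d247's successor item (i), seat abc-iut-w4-d026); TAKES NO SIDE.  Part IV of
four; PROOF-ONLY.  The (G3) countermodels of record come in two grades (spec §2 GRADE SCALE): STRONG-CONTENTFUL at the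
INTERFACE level (`GapWitnessNV.thm311_bridgeHyps_not_imp_statement_contentful` p414526, w5-d247's
`NaiveWitness.thm311_contentful_not_imp_statement` p415889 — over `toyIndex`, no provenance) and STRONG-DEGENERATE at the
PROVENANCE level (this seat's A-4′ `Cor312Vol.thm311_bridgeHyps_isSettingOf_not_imp_statement` p412888 — every initial
Θ-datum `D`, `IsSettingOf D P`, but `Ψ = ∅`).  This file closes the square: **STRONG-CONTENTFUL AT THE PROVENANCE
LEVEL.**  For EVERY collection of initial Θ-data `D` ([IUTchI] Def. 3.1, `InitialThetaData`) — NO side condition: `log(q) > 0`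
is abc-iut-c312-8's THEOREM `Cor312Prov.logq_pos` (`Cor312ProvenanceQ`) — over THE index skeleton of `D` (abc-iut-c312-5's `thetaIndexOfInitial D`; archimedean place included, several places over
one rational prime allowed), with `c := (1/2l)·log(q)` ([IUTchIV] p. 23) and abc-iut-c312-8's provenance link
`Cor312Prov.IsSettingOf D P`:
* `thm311_contentful_isSettingOf_not_imp_statement` — a full situation `F` satisfying c312-1's typed [IUTchIII]
  Thm. 3.11 (i) ∧ (ii) ∧ (iii) WITH CONTENT (nonempty zero-free splitting monoids of theta vectors in the sub-packets
  at every bad place of `D`, nonempty number-field copies (the whole global packet — unconstrained, as in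
  w5-d247's model), proper shells with the `m' = 1` unit image strictly inside, non-identity theater
  automorphisms, a non-trivially acting (Ind1),(Ind2)-group) and a setting `P` over `F`
  with the NATURAL glue (Θ ↦ `λ·𝒪` of radius `|q^{j²}|`, q ↦ radius `|q|`) that IS the situation of `D`
  (`IsSettingOf D P`), satisfies every bridge hypothesis, `|log(q)| > 0`, the Step-(v) ENCODING
  `−|log(Θ)| = stepVWeight·(−|log(q)|)` with `stepVWeight = (l⋇+1)(2l⋇+1)/6` at `D`'s OWN `l` — and VIOLATES the
  typed Cor. 3.12, the family of possible images of the Θ-pilot being the SINGLETON of its Kummer image;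
* `provenance_contentful_fork` — over THE SAME contentful `F`, the natural-glue setting `P₁` (¬Statement, Encodes,
  ¬IdentifiedReading) next to its identified re-glue `P₂ := P₁.identify` (abc-iut-w5-d068): SAME column, frames,
  q-pilot image and `−|log(q)|`, BOTH `IsSettingOf D`, `P₂` satisfying Team R's `IdentifiedReading`, the typed Corollary
  (attained, `−|log(Θ)| = −|log(q)|`) and NO Θ-degree encoding of weight `> 1` — w5-d247's `cor312_fork_over_contentful_thm311`
  lifted from `toyIndex` (`p = 2`, `l⋇ = 2`) to the provenance level of every genuine `D`.
For the 12:30Z (G3)/(R) wording: the non-derivability of typed Cor. 3.12 from typed Thm. 3.11 + bridge hypotheses +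
`|log(q)| > 0` + provenance, and the consistency of the identified reading with the same, hold at the provenance level
over a CONTENTFUL Thm-3.11 instance; the fork is decided by the glue field `Setting.thetaRegionOf` alone, which neither
typed Thm. 3.11 nor `IsSettingOf` constrains.  HONEST SCOPE: interface + provenance level (volumes at ONE supported
place; regions are cylinders along one packet coordinate; `IsSettingOf` pins the index and the NUMBER `−|log(q)|`, not
the regions); nothing here bears on which reading of [IUTchIII] Thm. 3.11 / Cor. 3.12 Step (xi) is right.  No `Prop`
fact; standard axioms. [claim: Mochizuki2012, status: disputed] [cite: ScholzeStix2018, §2.2 pp. 9–10]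
-/

noncomputable section

namespace Summit.ABC

namespace IUTFork

namespace Cor312Vol

namespace NaiveProv

open Thm311 Cor312 Cor312.IdentifiedNonVacuity Literature.IUT.LogThetaLattice

/-! ## 12. Index-generic packaging -/

/-- **Index-generic, volume-prescribed, CONTENTFUL gap witness**: over EVERY index skeleton `T` and for EVERY `c > 0`
there are a full situation `F` satisfying the typed Thm. 3.11 (i)∧(ii)∧(iii) with the contentfulness census as kernel
conjuncts, and a natural-glue setting `P` over `F` with every bridge hypothesis, `|log(q)| > 0`, `−|log(q)| = −c`
EXACTLY, the Step-(v) encoding, typed Cor. 3.12 FALSE, not the identified reading, nonempty proper pilot regions and a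
SINGLETON family of possible images (this seat's `GapWitnessProv.exists_gapWitness`, now contentful; w5-d247's
`thm311_contentful_not_imp_statement`, now index-generic). Instantiated at the prime `2`. [folklore] -/
theorem exists_contentfulWitness (T : ThetaIndex) (c : ℝ) (hc : 0 < c) :
    ∃ (F : FullSituation T) (P : Setting F.toLatticeSituation.toSituation),
      F.Statement ∧
      (∀ (n : ℤ) (v : T.V) (hv : v ∈ T.Vbad),
        ((F.D n).Ψ v hv).Nonempty ∧ (0 : F.L.StarPacket v) ∉ (F.D n).Ψ v hv) ∧
      (∀ (n : ℤ) (j : T.LabelStar), ((F.D n).Mmod j).Nonempty) ∧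
      (∀ (n : ℤ) (j : T.Label) (vQ : T.VQ),
        ((F.D n).shellPk j vQ).Nonempty ∧ (F.D n).shellPk j vQ ≠ Set.univ ∧
          ∀ m : ℤ, (F.col n).unitImage m 1 j vQ ⊂ (F.D n).shellPk j vQ) ∧
      (∀ n m : ℤ, ∃ a : F.link.AutHT n m, F.link.onDelta n m a ≠ CategoryTheory.Iso.refl _) ∧
      (∃ Φ ∈ Setting.indGroup F.toSituation, ∃ (j : T.Label) (vQ : T.VQ) (x : F.L.Packet j vQ), Φ j vQ x ≠ x) ∧
      BridgeHyps P ∧ P.AbsLogQPos ∧ P.negLogQ = -c ∧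
      P.negLogTheta = ((stepVWeight T * P.negLogQ : ℝ) : WithTop ℝ) ∧ ¬ P.Statement ∧ ¬ P.IdentifiedReading ∧
      (∀ (m : ℤ) (j : T.Label) (vQ : T.VQ),
        (P.thetaRegion m j vQ).Nonempty ∧ P.thetaRegion m j vQ ≠ Set.univ ∧
          (P.qRegion j vQ).Nonempty ∧ P.qRegion j vQ ≠ Set.univ ∧
            P.possibleImages j vQ = {P.thetaRegion m j vQ}) := by
  haveI : Fact (Nat.Prime 2) := ⟨Nat.prime_two⟩
  obtain ⟨v, -⟩ := T.Vbad_nonempty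
  obtain ⟨h1, h2, h3, h4, h5⟩ := full_contentful 2 (T.over v) c (T.over v)
  exact ⟨full 2 (T.over v) c, setting 2 (T.over v) c, full_statement 2 (T.over v) c, h1, h2, h3, h4, h5,
    bridgeHyps 2 (T.over v) c hc.le, absLogQPos 2 (T.over v) c hc, negLogQ_eq 2 (T.over v) c,
    encodes 2 (T.over v) c, not_statement 2 (T.over v) c hc, not_identifiedReading 2 (T.over v) c,
    regions_census 2 (T.over v) c⟩

/-! ## 13. At the provenance level: every initial Θ-datum -/

open Literature.IUT.HodgeTheaters NumberField

variable {F K Fbar : Type} [Field F] [NumberField F] [Field K] [NumberField K] [Algebra F K] [Field Fbar]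
  [Algebra F Fbar] [Algebra K Fbar] {E : WeierstrassCurve F} [E.IsElliptic] {l : ℕ} {Pb : BadPlacePredicates K}

/-- **TEAM A GAP ISOLATION, CONTENTFUL, AT THE PROVENANCE LEVEL ([IUTchIII] Cor. 3.12, Step (xi); support piece
«G-NV-PROV»).**  For EVERY collection of initial Θ-data `D` ([IUTchI] Def. 3.1; no side condition — `log(q) > 0` is
the theorem `Cor312Prov.logq_pos`, [IUTchIV] p. 23) there are, over THE index skeleton of `D` (`thetaIndexOfInitial D`), a full situation `F₁` satisfying c312-1's typed
Thm. 3.11 (i)∧(ii)∧(iii) WITH CONTENT — nonempty zero-free splitting monoids (sign-translates of theta vectors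
`q^{j²}` in the sub-packets) at every bad place of `D`, nonempty number-field copies, proper shells with the `m' = 1`
unit image strictly inside, non-identity theater automorphisms, a non-trivially acting (Ind1),(Ind2)-group — and a
setting `P` over `F₁` that IS "the situation of `D`" (abc-iut-c312-8's `Cor312Prov.IsSettingOf D P`:
`−|log(q)| = −(1/2l)·log(q)` of `D`), with the natural glue, every bridge hypothesis, `|log(q)| > 0`, the Step-(v)
ENCODING `−|log(Θ)| = ((l⋇+1)(2l⋇+1)/6)·(−|log(q)|)` at `D`'s own `l`, typed Cor. 3.12 FALSE, not Team R's identified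
reading, and a SINGLETON family of possible images of the Θ-pilot at every packet.  Interface + provenance level; no
judgement on print. [folklore] -/
theorem thm311_contentful_isSettingOf_not_imp_statement (D : InitialThetaData F K Fbar E l Pb) :
    ∃ (F₁ : FullSituation (Thm311.Real.thetaIndexOfInitial D))
      (P : Setting F₁.toLatticeSituation.toSituation),
      Cor312Prov.IsSettingOf D P ∧ F₁.Statement ∧
      (∀ (n : ℤ) (v : (Thm311.Real.thetaIndexOfInitial D).V) (hv : v ∈ (Thm311.Real.thetaIndexOfInitial D).Vbad),
        ((F₁.D n).Ψ v hv).Nonempty ∧ (0 : F₁.L.StarPacket v) ∉ (F₁.D n).Ψ v hv) ∧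
      (∀ (n : ℤ) (j : (Thm311.Real.thetaIndexOfInitial D).LabelStar), ((F₁.D n).Mmod j).Nonempty) ∧
      (∀ (n : ℤ) (j : (Thm311.Real.thetaIndexOfInitial D).Label) (vQ : (Thm311.Real.thetaIndexOfInitial D).VQ),
        ((F₁.D n).shellPk j vQ).Nonempty ∧ (F₁.D n).shellPk j vQ ≠ Set.univ ∧
          ∀ m : ℤ, (F₁.col n).unitImage m 1 j vQ ⊂ (F₁.D n).shellPk j vQ) ∧
      (∀ n m : ℤ, ∃ a : F₁.link.AutHT n m, F₁.link.onDelta n m a ≠ CategoryTheory.Iso.refl _) ∧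
      (∃ Φ ∈ Setting.indGroup F₁.toSituation,
        ∃ (j : (Thm311.Real.thetaIndexOfInitial D).Label) (vQ : (Thm311.Real.thetaIndexOfInitial D).VQ)
          (x : F₁.L.Packet j vQ), Φ j vQ x ≠ x) ∧
      BridgeHyps P ∧ P.AbsLogQPos ∧
      P.negLogTheta = ((stepVWeight (Thm311.Real.thetaIndexOfInitial D) * P.negLogQ : ℝ) : WithTop ℝ) ∧
      ¬ P.Statement ∧ ¬ P.IdentifiedReading ∧
      (∀ (m : ℤ) (j : (Thm311.Real.thetaIndexOfInitial D).Label) (vQ : (Thm311.Real.thetaIndexOfInitial D).VQ),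
        P.possibleImages j vQ = {P.thetaRegion m j vQ}) := by
  obtain ⟨F₁, P, hF, h1, h2, h3, h4, h5, hB, hA, hq', hE, hN, hR, hreg⟩ :=
    exists_contentfulWitness (Thm311.Real.thetaIndexOfInitial D) (Cor312Prov.absLogq D) (Cor312Prov.absLogq_pos D)
  exact ⟨F₁, P, Cor312Prov.isSettingOf_ofInitial D P hq', hF, h1, h2, h3, h4, h5, hB, hA, hE, hN, hR,
    fun m j vQ => (hreg m j vQ).2.2.2.2⟩

/-- **THE Cor. 3.12 FORK OVER ONE CONTENTFUL INSTANCE OF THE TYPED Thm. 3.11, AT THE PROVENANCE LEVEL.**  For EVERY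
collection of initial Θ-data `D` (no side condition) there are, over the index skeleton of `D`, ONE full situation `F₁`
satisfying the typed [IUTchIII] Thm. 3.11 (i)∧(ii)∧(iii) with contentful data (census as kernel conjuncts) and TWO
verbatim settings `P₁`, `P₂` over `F₁` — BOTH "the situation of `D`" in abc-iut-c312-8's sense (`IsSettingOf D P₁`,
`IsSettingOf D P₂`), with the same column, the same hull frames, the same q-pilot image and the same
`−|log(q)| = −(1/2l)·log(q)` — both satisfying every bridge hypothesis and `|log(q)| > 0`, such that `P₁` (natural glue:
Θ ↦ `λ·𝒪` of radius `|q^{j²}|`) satisfies the Step-(v) ENCODING, VIOLATES the typed Cor. 3.12 and is not the identified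
reading, while `P₂ := P₁.identify` (abc-iut-w5-d068's re-glue: identified glue) satisfies Team R's `IdentifiedReading`
and the typed Cor. 3.12 (attained: `−|log(Θ)| = −|log(q)|`) and violates every Θ-degree encoding of weight `> 1`.
(w5-d247's `cor312_fork_over_contentful_thm311`, p416706, lifted from `toyIndex` to the provenance level; the fork is
decided by the glue field `Setting.thetaRegionOf` alone.) Interface + provenance level; no judgement on print.
[folklore] -/
theorem provenance_contentful_fork (D : InitialThetaData F K Fbar E l Pb) :
    ∃ (F₁ : FullSituation (Thm311.Real.thetaIndexOfInitial D))
      (P₁ P₂ : Setting F₁.toLatticeSituation.toSituation),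
      Cor312Prov.IsSettingOf D P₁ ∧ Cor312Prov.IsSettingOf D P₂ ∧ F₁.Statement ∧
      (∀ (n : ℤ) (v : (Thm311.Real.thetaIndexOfInitial D).V) (hv : v ∈ (Thm311.Real.thetaIndexOfInitial D).Vbad),
        ((F₁.D n).Ψ v hv).Nonempty ∧ (0 : F₁.L.StarPacket v) ∉ (F₁.D n).Ψ v hv) ∧
      (∀ (n : ℤ) (j : (Thm311.Real.thetaIndexOfInitial D).Label) (vQ : (Thm311.Real.thetaIndexOfInitial D).VQ)
        (m : ℤ), (F₁.col n).unitImage m 1 j vQ ⊂ (F₁.D n).shellPk j vQ) ∧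
      (∀ n m : ℤ, ∃ a : F₁.link.AutHT n m, F₁.link.onDelta n m a ≠ CategoryTheory.Iso.refl _) ∧
      (∃ Φ ∈ Setting.indGroup F₁.toSituation,
        ∃ (j : (Thm311.Real.thetaIndexOfInitial D).Label) (vQ : (Thm311.Real.thetaIndexOfInitial D).VQ)
          (x : F₁.L.Packet j vQ), Φ j vQ x ≠ x) ∧
      (P₂.n = P₁.n ∧ P₂.frame = P₁.frame ∧ (∀ j vQ, P₂.qRegion j vQ = P₁.qRegion j vQ) ∧ P₂.negLogQ = P₁.negLogQ) ∧
      (BridgeHyps P₁ ∧ P₁.AbsLogQPos ∧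
        P₁.negLogTheta = ((stepVWeight (Thm311.Real.thetaIndexOfInitial D) * P₁.negLogQ : ℝ) : WithTop ℝ) ∧
          ¬ P₁.Statement ∧ ¬ P₁.IdentifiedReading) ∧
      (BridgeHyps P₂ ∧ P₂.AbsLogQPos ∧ P₂.IdentifiedReading ∧ P₂.Statement ∧
        P₂.negLogTheta = ((P₂.negLogQ : ℝ) : WithTop ℝ) ∧
          ¬ ∃ w : ℝ, 1 < w ∧ P₂.negLogTheta = ((w * P₂.negLogQ : ℝ) : WithTop ℝ)) := by
  haveI : Fact (Nat.Prime 2) := ⟨Nat.prime_two⟩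
  set T := Thm311.Real.thetaIndexOfInitial D
  have hc : 0 < Cor312Prov.absLogq D := Cor312Prov.absLogq_pos D
  obtain ⟨v, -⟩ := T.Vbad_nonempty
  obtain ⟨h1, -, h3, h4, h5⟩ := full_contentful 2 (T.over v) (Cor312Prov.absLogq D) (T.over v)
  have hS₁ : Cor312Prov.IsSettingOf D (setting 2 (T.over v) (Cor312Prov.absLogq D)) :=
    Cor312Prov.isSettingOf_ofInitial D _ (negLogQ_eq 2 (T.over v) _)
  refine ⟨full 2 (T.over v) (Cor312Prov.absLogq D), setting 2 (T.over v) (Cor312Prov.absLogq D),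
    (setting 2 (T.over v) (Cor312Prov.absLogq D)).identify, hS₁, hS₁.identify, full_statement 2 (T.over v) _, h1,
    fun n j vQ m => (h3 n j vQ).2.2 m, h4, h5, ⟨rfl, rfl, fun _ _ => rfl, rfl⟩,
    ⟨bridgeHyps 2 (T.over v) _ hc.le, absLogQPos 2 (T.over v) _ hc, encodes 2 (T.over v) _,
      not_statement 2 (T.over v) _ hc, not_identifiedReading 2 (T.over v) _⟩,
    ⟨identify_bridgeHyps 2 (T.over v) _ hc.le, identify_absLogQPos 2 (T.over v) _ hc,
      identify_identifiedReading 2 (T.over v) _, (identify_statement 2 (T.over v) _).1,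
      (identify_statement 2 (T.over v) _).2,
      (identify_identifiedReading 2 (T.over v) _).not_encodes (identify_absLogQPos 2 (T.over v) _ hc)⟩⟩

end NaiveProv

end Cor312Vol

end IUTFork

end Summit.ABC

end
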